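import Summits.CriticalPhenomena.Ising3DConformalLimit.Theses.HyperoctahedralRP
import Literature.Probability.LatticeModels.GKSInequalities
import Literature.Probability.LatticeModels.CriticalCorrWellDefined
import Literature.Probability.LatticeModels.GriffithsMonotonicity
import Summits.CriticalPhenomena.Ising3DConformalLimit.Theorems.MoebiusLimitOfTwoPointLaw.Negative.TwoPointConvergence
import HarnessLib

/-!
# Even orders of a non-degenerate scaling limit of `criticalCorr 3` are positive: stub
# `stub_evenPos` of line `inversion-defect-involution` for crux `InversionUpgradeNormalised`
# (stmt-CriticalPhenomena-1982)

Statement.  Let `S` be a pointwise scaling limit of the critical `ℤ³` Ising correlators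
`criticalCorr 3` under a renormalisation `ρ` (positive on `(0,1]`), with non-degenerate two-point
function (`0 < S 2 x` for `x₀ ≠ x₁`).  Then `0 < S n x` for every EVEN `n` and every
non-coincident configuration `x`.

Proof (GKS II in the limit, strong induction on the even order `n`).
* `n = 0`: the empty spin monomial is the constant `1`, so `criticalCorr 3 0 ≡ 1` and the
  rescaled correlator of order `0` is constantly `1` (tree theorem
  `MoebiusLimitOfTwoPointLaw.Negative.rescaledCorrelator_arity_zero`), whence the limit
  `S 0 x = 1 > 0` by uniqueness of limits along the `NeBot` filter `𝓝[>] 0`.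
* `n = 2`: the non-degeneracy hypothesis.
* `n = m + 2`, `m` even: the infinite-volume second Griffiths inequality for the plus state at
  `β_c` (`plusCorr_mul_le`, Friedli–Velenik 2017, Thm. 3.20, eq. (3.22)) gives, for ARBITRARY sites
  (coincidences allowed, spin monomials turned into spin products of the odd-multiplicity sets by
  `exists_spinMonomial_eq_spinProduct` and `σ_A σ_B = σ_{A ∆ B}`),
  `G_m(y₁..y_m) · G_2(y_{m+1}, y_{m+2}) ≤ G_{m+2}(y)` (`criticalCorr_split_le`).  Multiplying by
  `ρ(δ)^{m+2} = ρ(δ)^m ρ(δ)^2 ≥ 0` (even power) this is an inequality between rescaled correlators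
  at every mesh `δ`, and passing to the limit `δ → 0⁺` at the non-coincident configuration `x`
  (whose sub-configurations `x ∘ Fin.castAdd 2`, `x ∘ Fin.natAdd m` stay non-coincident) gives
  `0 < S_m(x') S_2(x'') ≤ S_{m+2}(x)` by the induction hypothesis and non-degeneracy.

References: S. Friedli, Y. Velenik, *Statistical Mechanics of Lattice Systems* (CUP 2017),
Thm. 3.20 (GKS inequalities), §3.6.1 (`σ_A σ_B = σ_{A∆B}`).
-/

noncomputable section

open Filter Topology
open Literature.Probability.LatticeModels EuclideanGeometry

namespace Summit.CriticalPhenomena.Ising3DConformalLimit.Cruxes.InversionUpgradeNormalised.InversionDefectInvolution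

/-! ### Lattice input: the GKS II splitting inequality -/

/-- **GKS II with multiplicities for the critical correlators.**  For arbitrary sites
`y : Fin (m + 2) → ℤ³` (coincidences allowed),
`⟨∏_{i<m} σ_{yᵢ}⟩_{β_c} · ⟨σ_{y_m} σ_{y_{m+1}}⟩_{β_c} ≤ ⟨∏_{i<m+2} σ_{yᵢ}⟩_{β_c}`: the spin monomials
are spin products `σ_A`, `σ_B`, `σ_{A ∆ B}` of the odd-multiplicity sets, and the second Griffiths
inequality holds for the plus state at `β_c ≥ 0`, `h = 0` (Friedli–Velenik 2017, Thm. 3.20,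
eq. (3.22), in the infinite-volume limit: `plusCorr_mul_le`). -/
theorem criticalCorr_split_le {m : ℕ} (y : Fin (m + 2) → Site 3) :
    criticalCorr 3 m (fun i => y (Fin.castAdd 2 i)) *
        criticalCorr 3 2 (fun i => y (Fin.natAdd m i)) ≤
      criticalCorr 3 (m + 2) y := by
  -- adapted from Cruxes/GapForcesFarMerging/Disproof.lean `criticalCorr_griffiths`
  classical
  obtain ⟨A, hA⟩ := exists_spinMonomial_eq_spinProduct (fun i => y (Fin.castAdd 2 i))
  obtain ⟨B, hB⟩ := exists_spinMonomial_eq_spinProduct (fun i => y (Fin.natAdd m i))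
  have hy : spinMonomial y = spinProduct (symmDiff A B) := by
    funext s
    have h1 : spinMonomial y s =
        spinMonomial (fun i => y (Fin.castAdd 2 i)) s * spinMonomial (fun i => y (Fin.natAdd m i)) s := by
      simp only [spinMonomial]
      exact Fin.prod_univ_add _
    rw [h1, hA, hB, spinProduct_mul_spinProduct]
  show plusExpect 3 (criticalBeta 3) 0 (spinMonomial fun i => y (Fin.castAdd 2 i)) *
      plusExpect 3 (criticalBeta 3) 0 (spinMonomial fun i => y (Fin.natAdd m i)) ≤
    plusExpect 3 (criticalBeta 3) 0 (spinMonomial y)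
  rw [hA, hB, hy]
  exact plusCorr_mul_le (criticalBeta_nonneg 3) le_rfl A B

/-- The splitting inequality for the rescaled correlators at every mesh `δ` and every
configuration `x : Fin (m + 2) → ℝ³`, provided `m + 2` is even (so that `ρ(δ)^{m+2} ≥ 0`):
`(ρ^m G_m[x'/δ]) · (ρ^2 G_2[x''/δ]) ≤ ρ^{m+2} G_{m+2}[x/δ]` with `x' = x ∘ Fin.castAdd 2`,
`x'' = x ∘ Fin.natAdd m`. -/
theorem rescaledCorrelator_split_le (ρ : ℝ → ℝ) {m : ℕ} (hm : Even (m + 2)) (δ : ℝ)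
    (x : Fin (m + 2) → EuclideanSpace ℝ (Fin 3)) :
    rescaledCorrelator (criticalCorr 3) ρ m δ (fun i => x (Fin.castAdd 2 i)) *
        rescaledCorrelator (criticalCorr 3) ρ 2 δ (fun i => x (Fin.natAdd m i)) ≤
      rescaledCorrelator (criticalCorr 3) ρ (m + 2) δ x := by
  simp only [rescaledCorrelator_apply]
  have key := criticalCorr_split_le (m := m) (fun i => latticeApprox δ (x i))
  have hρ0 : 0 ≤ ρ δ ^ (m + 2) := hm.pow_nonneg _
  calc ρ δ ^ m * criticalCorr 3 m (fun i => latticeApprox δ (x (Fin.castAdd 2 i))) *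
        (ρ δ ^ 2 * criticalCorr 3 2 (fun i => latticeApprox δ (x (Fin.natAdd m i))))
      = ρ δ ^ (m + 2) * (criticalCorr 3 m (fun i => latticeApprox δ (x (Fin.castAdd 2 i))) *
          criticalCorr 3 2 (fun i => latticeApprox δ (x (Fin.natAdd m i)))) := by
        rw [pow_add]; ring
    _ ≤ ρ δ ^ (m + 2) * criticalCorr 3 (m + 2) (fun i => latticeApprox δ (x i)) :=
        mul_le_mul_of_nonneg_left key hρ0

/-! ### The registered stub -/

/-- **stub_evenPos** (EvenPositivity).  Every pointwise scaling limit `S` of `criticalCorr 3`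
(renormalisation `ρ > 0` on `(0,1]`) with non-degenerate two-point function is strictly positive
at every even order on non-coincident configurations.  Strong induction on the even order:
`S 0 ≡ 1` (`criticalCorr 3 0 ≡ 1`, tree theorem `rescaledCorrelator_arity_zero`), `S 2 > 0` by
hypothesis, and
`0 < S_m(x') S_2(x'') ≤ S_{m+2}(x)` by GKS II passed to the limit
(`rescaledCorrelator_split_le`, `le_of_tendsto_of_tendsto'`). -/
theorem stub_evenPos :
    ∀ (ρ : ℝ → ℝ) (S : CorrFamily 3), (∀ δ ∈ Set.Ioc (0:ℝ) 1, 0 < ρ δ) →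
      HasPointwiseScalingLimit (criticalCorr 3) ρ S → IsNondegenerateTwoPoint S →
      ∀ n : ℕ, Even n → ∀ x ∈ NonCoincident 3 n, 0 < S n x := by
  intro ρ S _hρ hlim hnd n
  induction n using Nat.strong_induction_on with
  | _ n ih =>
    intro hn x hx
    rcases Nat.lt_or_ge n 2 with hlt | hge
    · -- n = 0 (n = 1 is not even)
      interval_cases n
      · have h := (hlim 0).tendsto_at hx
        have h1 : Tendsto (fun δ => rescaledCorrelator (criticalCorr 3) ρ 0 δ x) (𝓝[>] (0 : ℝ))
            (𝓝 1) :=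
          tendsto_const_nhds.congr fun δ =>
            (Theorems.MoebiusLimitOfTwoPointLaw.Negative.rescaledCorrelator_arity_zero ρ δ x).symm
        rw [tendsto_nhds_unique h h1]
        exact one_pos
      · exact absurd hn (by decide)
    rcases eq_or_lt_of_le hge with rfl | hgt
    · -- n = 2: non-degeneracy
      exact hnd x hx
    · -- n = m + 2 with m even
      obtain ⟨m, rfl⟩ := Nat.exists_eq_add_of_le' hge
      have hm : Even m := by
        rcases Nat.even_or_odd m with hm | hm
        · exact hm
        · exfalso
          rcases hm with ⟨k, rfl⟩
          rcases hn with ⟨j, hj⟩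
          omega
      have hinj : Function.Injective x := hx
      have hx' : (fun i => x (Fin.castAdd 2 i)) ∈ NonCoincident 3 m :=
        hinj.comp (Fin.castAdd_injective m 2)
      have hx'' : (fun i => x (Fin.natAdd m i)) ∈ NonCoincident 3 2 :=
        hinj.comp (Fin.natAdd_injective 2 m)
      have hB : 0 < S m (fun i => x (Fin.castAdd 2 i)) := ih m (by omega) hm _ hx'
      have hC : 0 < S 2 (fun i => x (Fin.natAdd m i)) := hnd _ hx''
      have hT := (hlim (m + 2)).tendsto_at hx
      have hT' := (hlim m).tendsto_at hx'
      have hT'' := (hlim 2).tendsto_at hx''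
      have hle : S m (fun i => x (Fin.castAdd 2 i)) * S 2 (fun i => x (Fin.natAdd m i)) ≤
          S (m + 2) x :=
        le_of_tendsto_of_tendsto' (hT'.mul hT'') hT fun δ => rescaledCorrelator_split_le ρ hn δ x
      exact lt_of_lt_of_le (mul_pos hB hC) hle

end Summit.CriticalPhenomena.Ising3DConformalLimit.Cruxes.InversionUpgradeNormalised.InversionDefectInvolution

end
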